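import Summits.QuantumFields.YangMills.Theorems.BalabanUVNodesPortS1Sect5AtRecord
import Summits.QuantumFields.YangMills.Theorems.BalabanUVNodesPortS1Sect4ChartSmooth

/-!
# NODE O port, row PT-A-2 — THE §5 PACKAGE AT THE RE-CENTRED RECORD WITH THE SMOOTHNESS ROW DISCHARGED: `sect5_recordPlimAx_of_rows₂` (FILE `…Sect5AtRecord`) read against
# FORMAT⁺ᴳ at level `k` (the item's consequent = Thm 3's induction hypothesis) + the signed token [12], via FILE `…Sect4ChartSmooth` — the `C²`-at-`0` row is gone

CITATION HEADER.  [I] = [Balaban1987RG1]: (1.6)–(1.7), (1.9) p. 261, (1.18) p. 263, (1.20)–(1.22) p. 264, (4.14) p. 284, (4.32)–(4.33) p. 289, (5.2)–(5.9) pp. 292–293; [15] =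
[Balaban1985Variational] Prop. 9 p. 309.  Porter PT-A-2 (`ymgap-nodeO-port-PTA-2`), `--supports stmt-QuantumFields-27930 --as helper`.  REUSED BY NAME: `…Sect5AtRecord.sect5_recordPlimAx_of_rows₂`,
`…Sect4ChartSmooth.eventually_contDiffAt_expChart_recordTermsAx_of_formatPlusG`.
WHAT IS PROVED (0 sorry, 0 def): ★★★ `sect5_recordPlimAx_of_formatPlusG_rows` — `IndexSymmetric ∧ PermCovariant ∧ ReflCovariant ∧ WardFirst` for `recordPlimAx F a₀ ε₂₉ k v` ((5.6)–(5.9)) and, for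
all large `K`, (4.14) `D(expChart)(0) = 0`, (A4) `Π^{ab} = δ^{ab}Π`, (5.4) translation of the two-point kernel — FROM: FORMAT⁺ᴳ at level `k` (radii `α₀, α₁ > 0`, any `E₀, κ`, volumes
`recordK₀ F Mc k + n`), token [12]'s shape, `PolLimitExists`, and the N09-shape rows of `…Sect5AtRecord` ([B11] on the domains, (F7a), (F7a-supp), (I19), numerics).  The rows that REMAIN
displayed are exactly those; the `C²` row of the gen-2∕3 files is now a consequence of the induction hypothesis.
HONEST FRAMING.  Bookkeeping (one composition); nothing of Bałaban's estimates asserted, ported or discharged; 27930 signed-open (⁸-Ax-LR4), no claim held; finite 𝕋⁴ at fixed ε — NOT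
continuum∕OS∕Clay; the Yang–Mills mass gap is NOT proved by any of this.
-/

noncomputable section

open scoped Matrix.Norms.L2Operator Topology

namespace Summit.QuantumFields.YangMills.Theorems.BalabanUVNodesPortS1

open Filter MeasureTheory
open Literature.MathematicalPhysics.QuantumFieldTheory.Balaban1983to89
open Literature.MathematicalPhysics.QuantumFieldTheory.Balaban1983to89.Node00
open Literature.MathematicalPhysics.QuantumFieldTheory.Balaban1983to89.ExpMeanLog (deltaSU)
open T4Continuum (T4Family)
open Summit.QuantumFields.YangMills.Theorems.K0RecordFormatNames
open B12PolarizationTensor120 (expChart polComp)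
open B12Transverse536 (WardFirst ReflCovariant)
open Beta.PolarizationSign (IndexSymmetric)
open FederbushMean (deltaFed)
open GaugeField (gaugeAct)

variable (F : T4Family) (a₀ ε₂₉ : ℝ)

/-- **★★★ THE §5 PACKAGE AT THE RECORD FROM FORMAT⁺ᴳ + [12] + THE N09-SHAPE ROWS** — `sect5_recordPlimAx_of_rows₂` with its `C²`-at-`0` row supplied by
`eventually_contDiffAt_expChart_recordTermsAx_of_formatPlusG`: the symmetry∕Ward conjunction (5.6)–(5.9) for `recordPlimAx F a₀ ε₂₉ k v` and, for all large volumes, (4.14), (A4) and (5.4).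
[cite: Balaban1987RG1, (1.6)–(1.7) p.261, (1.18) p.263, (1.20)–(1.22) p.264, (4.14) p.284, (4.32)–(4.33) p.289, (5.2)–(5.9) pp.292–293; Balaban1985Variational, Prop. 9 p.309] -/
theorem sect5_recordPlimAx_of_formatPlusG_rows (Mc k : ℕ) (v : Fin (k + 1) → ℝ) {α₀ α₁ E₀ κ : ℝ} (hα₀ : 0 < α₀) (hα₁ : 0 < α₁)
    (hε₀ : 0 < (thetaFill F a₀ ε₂₉).ν.ε₀) (hεreg : 0 < (thetaFill F a₀ ε₂₉).ν.εreg) (hεbg : 0 < (thetaFill F a₀ ε₂₉).εbg)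
    (hF : letI θ := thetaFill F a₀ ε₂₉; letI := θ.instVβ₁; letI := θ.instVβ₂; letI := θ.instιβ;
      B12FormatPlus.FormatPlusG (fun n => recordDomSys F Mc k (recordK₀ F Mc k + n)) (fun n => recordBondCount F (recordK₀ F Mc k + n))
        (fun n => recordAct F (recordK₀ F Mc k + n)) (fun n => recordUc F Mc k α₀ α₁ (recordK₀ F Mc k + n)) (fun n => recordCoords F Mc k (recordK₀ F Mc k + n))
        (fun n => recordChartDimJ F (recordK₀ F Mc k + n)) (fun n => recordChartJ F Mc k (recordK₀ F Mc k + n))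
        (fun n => recordΦfAx F a₀ ε₂₉ k v (recordK₀ F Mc k + n)) (fun n => recordEmbJ F θ k (recordK₀ F Mc k + n))
        (fun n => recordWrapCtr F Mc k (recordK₀ F Mc k + n)) (fun n => recordDomEmbCtr F Mc k (recordK₀ F Mc k + n))
        (fun n _ => recordCoordProjCtr F (recordK₀ F Mc k + n)) E₀ κ)
    (hreg : letI θ := thetaFill F a₀ ε₂₉; letI := θ.instVβ₁; letI := θ.instVβ₂; letI := θ.instιβ;
      ∀ n : ℕ, AnalyticAt ℝ (fun B : recordW F a₀ ε₂₉ k (recordK₀ F Mc k + n) =>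
        fun (b : PBond (F.P (recordK₀ F Mc k + n)) 0) (i i' : Fin 2) =>
          ((recordBgField F θ k (recordK₀ F Mc k + n) B b : SU 2) : Matrix (Fin 2) (Fin 2) ℂ) i i') 0)
    (hlim : letI θ := thetaFill F a₀ ε₂₉
      letI := θ.instVβ₁; letI := θ.instVβ₂; letI := θ.instιβ
      PolLimitExists F (k + 1) (fun K => recordTermsAx F a₀ ε₂₉ k v K) θ.ρ8 θ.bV)
    (hrows : letI θ := thetaFill F a₀ ε₂₉
      ∀ᶠ K in atTop, k + 1 ≤ K ∧
        (((((F.P K).d * (F.P K).L : ℕ) : ℝ)) ^ 2 / 4 * θ.ν.ε₀ < deltaFed (Fin 2) ∧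
          (143 * (((((F.P K).d + 4 : ℕ) : ℝ)) ^ 2 / 4) ^ 2) * θ.ν.εreg ≤ 1 / 3 ∧
          2 * θ.ν.εreg ≤ 2 * deltaSU (Fin 2) / ((((F.P K).d + 4) * (F.P K).L : ℕ) : ℝ) ^ 2 ∧ 2 * θ.ν.εreg ≤ θ.ν.ε₀ * ((F.P K).L : ℝ) ^ 2 ∧
          (143 * (((((F.P K).d + 4 : ℕ) : ℝ)) ^ 2 / 4) ^ 2) * θ.εbg ≤ 1 / 3 ∧
          2 * θ.εbg ≤ 2 * deltaSU (Fin 2) / ((((F.P K).d + 4) * (F.P K).L : ℕ) : ℝ) ^ 2 ∧ 2 * θ.εbg ≤ θ.ν.ε₀ * ((F.P K).L : ℝ) ^ 2) ∧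
        (∀ j < k + 1, ∀ W ∈ domAltOfRecord F 2 θ.ν K (j + 1), UkExists F 2 K (j + 1) θ.ν.εreg W ∧ UniqueUkOrbit F 2 K (j + 1) θ.ν.εreg W) ∧
        (∀ j < k + 1, domAltOfRecord F 2 θ.ν K (j + 1) ⊆
          regSetOfRecord F 2 K j (betaInputOfRecord F 2 (TβOfRecord₁₃ F 2) (chiβOfRecord₁₃Ax F 2 θ) K (T4FlagMemory.extd v) j)) ∧
        (∀ j < k + 1, ∀ᵐ U ∂(fieldMeasure (F.P K) j (SU 2)), (avOfRecord F 2 K j).avg U ∈ domAltOfRecord F 2 θ.ν K (j + 1) →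
          U ∉ domAltOfRecord F 2 θ.ν K j → chiβOfRecord₁₃Ax F 2 θ K (T4FlagMemory.extd v) j U = 0) ∧
        (∀ j < k + 1, Integrable (betaInputOfRecord F 2 (TβOfRecord₁₃ F 2) (chiβOfRecord₁₃Ax F 2 θ) K (T4FlagMemory.extd v) j) (fieldMeasure (F.P K) j (SU 2))) ∧
        (∀ W ∈ domAltOfRecord F 2 θ.ν K (k + 1), UkExists F 2 K (k + 1) θ.εbg W ∧ UniqueUkOrbit F 2 K (k + 1) θ.εbg W)) :
    letI θ := thetaFill F a₀ ε₂₉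
    letI := θ.instVβ₁; letI := θ.instVβ₂; letI := θ.instιβ
    (IndexSymmetric (recordPlimAx F a₀ ε₂₉ k v) ∧ B12Beta.PermCovariant (recordPlimAx F a₀ ε₂₉ k v) ∧ ReflCovariant (recordPlimAx F a₀ ε₂₉ k v) ∧
      WardFirst (recordPlimAx F a₀ ε₂₉ k v)) ∧
    ∀ᶠ K in atTop,
      fderiv ℝ (expChart (recordTermsAx F a₀ ε₂₉ k v K) θ.ρ8) 0 = 0 ∧
      (∀ (μ : Fin (F.P K).d) (x : Site (F.P K) (k + 1)) (ν : Fin (F.P K).d) (y : Site (F.P K) (k + 1)) (i j : θ.ιβ), i ≠ j →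
        polComp ℝ (expChart (recordTermsAx F a₀ ε₂₉ k v K) θ.ρ8) θ.bV μ x i ν y j = 0) ∧
      (∀ (μ : Fin (F.P K).d) (x : Site (F.P K) (k + 1)) (ν : Fin (F.P K).d) (y : Site (F.P K) (k + 1)) (i : θ.ιβ),
        polComp ℝ (expChart (recordTermsAx F a₀ ε₂₉ k v K) θ.ρ8) θ.bV μ x i ν y i = polScalar (recordTermsAx F a₀ ε₂₉ k v K) θ.ρ8 θ.bV μ x ν y) ∧
      (∀ (μ : Fin (F.P K).d) (x : Site (F.P K) (k + 1)) (ν : Fin (F.P K).d) (y a : Site (F.P K) (k + 1)),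
        polScalar (recordTermsAx F a₀ ε₂₉ k v K) θ.ρ8 θ.bV μ (x + a) ν (y + a) = polScalar (recordTermsAx F a₀ ε₂₉ k v K) θ.ρ8 θ.bV μ x ν y) :=
  sect5_recordPlimAx_of_rows₂ F a₀ ε₂₉ k v hε₀ hεreg hεbg hlim
    (eventually_contDiffAt_expChart_recordTermsAx_of_formatPlusG F a₀ ε₂₉ Mc k v hα₀ hα₁ hF hreg 2) hrows

end Summit.QuantumFields.YangMills.Theorems.BalabanUVNodesPortS1

end
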